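import Summits.BirchSwinnertonDyer.Rank1Residual.Additive.TameBranchLambdaParityLaw
import HarnessLib

/-!
# The typed RATIONAL tame-branch main conjecture `TameBranchRatCharEqAt` DELIVERS the λ-part and the
# EXACT leading-term identities modulo `μ` on every row (any `λ_an`): `λ(X) = λ_an`, exponent `= μ(X) + c`,
# rank 1: `ord Ш[p^∞] + ord Reg_p + ord ∏c + ord ℓ = μ(X) + ord_p[T¹]B + c + 1 + 2 ord #tors`,
# rank 0: `… = μ(X) + ord_p[0]⁺_f + c + 2 ord #tors`
# (cell `b2b-bsdres`, sub-cell additive-p2 = X3♯(G-ord)/X4♯(G-ord), gen 30; part 6)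

HONEST FRAMING (cell `b2b-bsdres`, run/shared/lean/b2b/bsd-rank1-residual/, verbatim in every
file): the goal of the cell is to DELETE the COMBINATION-SHAPED residual classes of the
Birch–Swinnerton-Dyer formula for ALL analytic-rank `≤ 1` elliptic curves over `ℚ` — "full BSD
formula for every rank `≤ 1` curve in class `C`" assembled STRICTLY from published theorems — so
that the rank-`≤ 1` remainder becomes exactly the CONSTRUCTION-SHAPED classes, which are TYPED
(missing-input `Prop`s), NOT attempted. This is not "finishing BSD". Sub-cell additive-p2: the
classes X3♯(G-ord) / X4♯(G-ord) are CONSTRUCTION-SHAPED and stay so; labels / RESIDUAL-MAP marks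
UNCHANGED; nothing is booked. Theorems only; the rational main conjecture enters as cc-typer-2's TYPED
input `TameBranchRatCharEqAt W p` (OUR conjecture shape, NOT in print — an explicit hypothesis binder),
Delbourgo 2002 (B) as `LeadingTermClauses W p Dh`. No definition, no named fact, no `sorry`.

## What and why (gen 29's successor item (3)(c))

Parts 1–5 proved the direction "λ-part ⟹ rational main conjecture at the pair (exponent `μ + c`)" and
realised it by the parity squeeze. This part is the CONVERSE at the typed level, closing the loop
**λ-part ⟺ `TameBranchRatCharEqAt`-conclusion at the pair**:

* §12 `lam_eq_and_exponent_eq_of_tameBranchRatCharEqAt`: `TameBranchRatCharEqAt W p` + ANY tuple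
  `(f, ε, α, B)` of the package with bound `p^c` and FIRST TOP at `n` ⟹ for every cyclotomic dual datum
  and every generator `fE` of `char_Λ X`: **`λ(fE) = n` (`= λ_an`) and the conjecture's exponent is
  `k = μ(fE) + c`** (so `k ≥ 0`; the integrality certificate of `TameBranchLower` §3 is automatic).
* §13 hence the EXACT identities modulo `μ` (equality cases of gen 29, every defect, (M) included):
  rank 1 (`[T¹]B ≠ 0`): Schneider, `#Ш[p^∞] < ∞`,
  **`ord_p #Ш[p^∞] + ord_p Reg_p + ord_p ∏c + ord_p ℓ = μ(fE) + ord_p[T¹]B + c + 1 + 2 ord_p #tors`**;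
  rank 0 (`[0]⁺_f ≠ 0`): **`… = μ(fE) + ord_p[0]⁺_f + c + 2 ord_p #tors`** — previously (gens 20/26) only
  for `λ_an = rank` via a unit coefficient. So on every row of the tame-branch route the located gap
  "rational MC (G)" is EXACTLY the λ-part, and under it BSD-shape ⟺ `μ(X) = 0` (up to `ℓ` and the
  period binder). Nothing booked; labels UNCHANGED.

References: Delbourgo 2002 Thm. (A), (B), (C) p. 40 [Delbourgo2002]; Delbourgo 1998 Main Conjecture
p. 151 [Delbourgo1998]; Greenberg–Vatsal 2000 p. 4 [GreenbergVatsal2000]; Washington GTM 83 §7.1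
[Washington1997]; `TameBranchLower.lean` (cc-typer-2), `TameBranchKatoDivisibility.lean` (gen 20),
`TameBranchExtraZerosRankOne/RankZero.lean` (gen 29), part 1 `TameBranchLambdaParityLaw.lean`. -/

set_option autoImplicit false

noncomputable section

open scoped Classical MatrixGroups ModularForm NumberField

open CongruenceSubgroup IsDedekindDomain WeierstrassCurve NumberField
  Literature.NumberTheory.EllipticCurves
  Literature.NumberTheory.EllipticCurves.ModularForms
  Literature.NumberTheory.EllipticCurves.Rank1Residual
  Literature.NumberTheory.EllipticCurves.Rank1Residual.Typed
  Literature.NumberTheory.EllipticCurves.Delbourgo2002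
  Summit.BirchSwinnertonDyer.Rank1Residual.X1.MuLambda
  Summit.BirchSwinnertonDyer.Rank1Residual.X1.ParitySqueeze
  Summit.BirchSwinnertonDyer.Rank1Residual.X1.RankOneParitySqueeze
  Summit.BirchSwinnertonDyer.Rank1Residual.X11a.LambdaNorm

namespace Summit.BirchSwinnertonDyer.Rank1Residual.Additive

/-! ### §12 The typed rational main conjecture ⟹ the λ-part, exponent `μ + c` -/

section LambdaPart

open TameBranchExtraZeros TameBranchLambdaParity

variable {W : WeierstrassCurve ℚ} [W.IsElliptic] [W.IsGloballyMinimal] {p : ℕ} [hp : Fact p.Prime]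
  {N : ℕ} [NeZero N] {f : CuspForm (Gamma0 N) 2}

/-- **`TameBranchRatCharEqAt` ⟹ THE λ-PART, with the exponent identified.** `p ≠ 2` additive of type (M)
or (G-ord), cc-typer-2's typed RATIONAL main conjecture `TameBranchRatCharEqAt W p`, ANY tuple
`(f, ε, α, B)` of the package (`orderOf ε = tameDefect`, `‖α‖ = 1`) with `‖[Tʲ]B‖ ≤ p^c` and FIRST TOP at
`n`. Then for every cyclotomic dual datum and every generator `fE` of `char_Λ X(E/ℚ_∞)`: `X` is torsion,
**`λ(fE) = n`**, and the conjecture holds with a generator `G`, `ι G = p^k·B`, **`k = μ(fE) + c`**.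
[cite: Delbourgo1998, Main Conjecture (p. 151) (shape; typed input)] [cite: GreenbergVatsal2000, p. 4]
[cite: Washington1997, §7.1] -/
theorem lam_eq_and_exponent_eq_of_tameBranchRatCharEqAt (hT : TameBranchRatCharEqAt W p)
    {ε : DirichletCharacter ℂ_[p] p} {α : ℚ_[p]} {B : PowerSeries ℚ_[p]}
    (hp2 : p ≠ 2) (hadd : Addv W p) (hloc : PotMult W p ∨ TypeGOrd W p)
    (hf : IsNewformOf W f) (hε : orderOf ε = tameDefect W p) (hα : ‖α‖ = 1)
    (hB : IsTameBranchOf f p ε α B) {c : ℕ} (hbd : ∀ j : ℕ, ‖PowerSeries.coeff j B‖ ≤ (p : ℝ) ^ c)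
    {n : ℕ} (hn : ‖PowerSeries.coeff n B‖ = (p : ℝ) ^ c)
    (hlt : ∀ i < n, ‖PowerSeries.coeff i B‖ < (p : ℝ) ^ c)
    {κ : ZpExtension ℚ p} {γ : Field.absoluteGaloisGroup ℚ}
    (hκ : κ.IsCyclotomic) (hγ : κ.IsTopGenerator γ) (hγ' : IsCyclotomicVariable p γ)
    (D : W.SelmerDualData κ γ) {fE : IwasawaAlgebra p} (hchar : D.charIdeal = Ideal.span {fE}) :
    D.IsTorsion ∧ fE ≠ 0 ∧ lam fE = n ∧
      ∃ (G : IwasawaAlgebra p) (k : ℤ), D.charIdeal = Ideal.span {G} ∧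
        iwasawaToPowerSeries p G = PowerSeries.C ((p : ℚ_[p]) ^ k) * B ∧ k = X1.MuLambda.mu fE + c := by
  have hpQ : (p : ℚ_[p]) ≠ 0 := Nat.cast_ne_zero.mpr hp.out.ne_zero
  obtain ⟨hX, G, k, hspanG, hι⟩ := hT ε α B hp2 hadd hloc hκ hγ hγ' hf hε hα hB D
  -- `G ≠ 0`: its image has the non-zero coefficient `p^k·[Tⁿ]B`
  have hBn : PowerSeries.coeff n B ≠ 0 := by
    intro h0
    rw [h0, norm_zero] at hn
    exact (pow_pos (show (0 : ℝ) < p by exact_mod_cast hp.out.pos) c).ne hn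
  have hG0 : G ≠ 0 := by
    intro h0
    have e : ((PowerSeries.coeff n G : ℤ_[p]) : ℚ_[p]) = (p : ℚ_[p]) ^ k * PowerSeries.coeff n B := by
      rw [← Wuthrich2014.coeff_iwasawaToPowerSeries p G n, hι, PowerSeries.coeff_C_mul]
    rw [h0] at e
    simp only [map_zero, PadicInt.coe_zero] at e
    exact (mul_ne_zero (zpow_ne_zero _ hpQ) hBn) e.symm
  have hspan : Ideal.span ({G} : Set (IwasawaAlgebra p)) = Ideal.span {fE} := by rw [← hspanG, hchar]
  have hfE0 : fE ≠ 0 := by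
    obtain ⟨u, hu⟩ := Ideal.span_singleton_eq_span_singleton.mp hspan
    rw [← hu]; exact mul_ne_zero hG0 u.ne_zero
  obtain ⟨hlam, hk⟩ := lam_eq_and_exponent_eq_of_span_eq_of_iota_eq_zpow hfE0 hspan hι hbd hn hlt
  exact ⟨hX, hfE0, hlam, G, k, hspanG, hι, hk⟩

end LambdaPart

/-! ### §13 The EXACT leading-term identities modulo `μ` under the typed rational main conjecture -/

section Exact

open TameBranchExtraZeros TameBranchLambdaParity

variable {W : WeierstrassCurve ℚ} [W.IsElliptic] [W.IsGloballyMinimal] {p : ℕ} [hp : Fact p.Prime]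
  {N : ℕ} [NeZero N] {f : CuspForm (Gamma0 N) 2}

/-- **RANK ONE under `TameBranchRatCharEqAt`: the exact identity with the extra zeros' contribution.**
`p ≠ 2` additive of type (M) or (G-ord), `TameBranchRatCharEqAt W p`, ANY tuple of the package with bound
`p^c`, FIRST TOP at `n` and `[T¹]B ≠ 0`, `rank_ℤ E(ℚ) = 1`, a (B)-datum. Then for every cyclotomic dual
datum with generator `fE`: Schneider, `#Ш[p^∞] < ∞`, `λ(fE) = n`, and
**`ord_p #Ш[p^∞] + ord_p Reg_p(E,Dh) + ord_p ∏c + ord_p ℓ = μ(fE) + ord_p[T¹]B + c + 1 + 2 ord_p #tors`**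
(gen 29's equality case, now unconditional under the typed conjecture; `n` arbitrary).
[cite: Delbourgo2002, Theorem (B) (p. 40)] [cite: Delbourgo1998, Main Conjecture (p. 151) (shape; typed input)]
[cite: Washington1997, §7.1] -/
theorem padicVal_eq_rankOne_of_tameBranchRatCharEqAt (hT : TameBranchRatCharEqAt W p)
    {ε : DirichletCharacter ℂ_[p] p} {α : ℚ_[p]} {B : PowerSeries ℚ_[p]}
    (hp2 : p ≠ 2) (hadd : Addv W p) (hloc : PotMult W p ∨ TypeGOrd W p)
    (hf : IsNewformOf W f) (hε : orderOf ε = tameDefect W p) (hα : ‖α‖ = 1)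
    (hB : IsTameBranchOf f p ε α B) {c : ℕ} (hbd : ∀ j : ℕ, ‖PowerSeries.coeff j B‖ ≤ (p : ℝ) ^ c)
    {n : ℕ} (hn : ‖PowerSeries.coeff n B‖ = (p : ℝ) ^ c)
    (hlt : ∀ i < n, ‖PowerSeries.coeff i B‖ < (p : ℝ) ^ c) (hB1 : PowerSeries.coeff 1 B ≠ 0)
    (hr1 : W.mordellWeilRank = 1) {Dh : PAdicHeightData W p} (hBcl : LeadingTermClauses W p Dh)
    {κ : ZpExtension ℚ p} {γ : Field.absoluteGaloisGroup ℚ}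
    (hκ : κ.IsCyclotomic) (hγ : κ.IsTopGenerator γ) (hγ' : IsCyclotomicVariable p γ)
    (D : W.SelmerDualData κ γ) [Module.Finite (IwasawaAlgebra p) D.X]
    {fE : IwasawaAlgebra p} (hchar : D.charIdeal = Ideal.span {fE}) :
    SchneiderConjecture Dh ∧ Finite (AddCommGroup.primaryComponent W.sha p) ∧ lam fE = n ∧
      ∃ ℓ : ℕ, ℓ ∣ p ^ 2 ∧ (ReductionNonAnomalous W p → ℓ = 1) ∧
        (padicValNat p (Nat.card (AddCommGroup.primaryComponent W.sha p)) : ℤ) +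
            (padicRegulator Dh).valuation + padicValNat p W.tamagawaProduct + padicValNat p ℓ =
          X1.MuLambda.mu fE + (PowerSeries.coeff 1 B).valuation + c + 1 +
            2 * padicValNat p W.torsionOrder := by
  obtain ⟨-, -, hlam, -⟩ := lam_eq_and_exponent_eq_of_tameBranchRatCharEqAt hT hp2 hadd hloc hf hε hα hB
    hbd hn hlt hκ hγ hγ' D hchar
  have hT' : TameBranchRatDvdAt W p := tameBranchRatDvdAt_of_tameBranchRatCharEqAt W p hT
  obtain ⟨hS, hfin, -, -, ℓ, hℓ, hna, -, hiff⟩ :=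
    schneider_and_padicVal_le_rankOne_of_tameBranchRatDvdAt_of_firstTop hT' hp2 hadd hloc hf hε hα hB hbd hn
      hlt hB1 hr1 hBcl hκ hγ hγ' D hchar
  exact ⟨hS, hfin, hlam, ℓ, hℓ, hna, hiff.mpr hlam⟩

/-- **RANK ZERO under `TameBranchRatCharEqAt`: the exact identity.** `p ≠ 2` additive of type (M) or
(G-ord), `TameBranchRatCharEqAt W p`, ANY tuple of the package with bound `p^c` and FIRST TOP at `n`,
`rank_ℤ E(ℚ) = 0`, `[0]⁺_f ≠ 0`, a (B)-datum. Then for every cyclotomic dual datum with generator `fE`: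
`#Ш[p^∞] < ∞`, `λ(fE) = n`, and
**`ord_p #Ш[p^∞] + ord_p Reg_p + ord_p ∏c + ord_p ℓ = μ(fE) + ord_p[0]⁺_f + c + 2 ord_p #tors`**
(`Reg_p = 1` in rank `0`). [cite: Delbourgo2002, Theorem (B) (p. 40)]
[cite: Delbourgo1998, Main Conjecture (p. 151) (shape; typed input)] [cite: Washington1997, §7.1] -/
theorem padicVal_eq_rankZero_of_tameBranchRatCharEqAt (hT : TameBranchRatCharEqAt W p)
    {ε : DirichletCharacter ℂ_[p] p} {α : ℚ_[p]} {B : PowerSeries ℚ_[p]}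
    (hp2 : p ≠ 2) (hadd : Addv W p) (hloc : PotMult W p ∨ TypeGOrd W p)
    (hf : IsNewformOf W f) (hε : orderOf ε = tameDefect W p) (hα : ‖α‖ = 1)
    (hB : IsTameBranchOf f p ε α B) {c : ℕ} (hbd : ∀ j : ℕ, ‖PowerSeries.coeff j B‖ ≤ (p : ℝ) ^ c)
    {n : ℕ} (hn : ‖PowerSeries.coeff n B‖ = (p : ℝ) ^ c)
    (hlt : ∀ i < n, ‖PowerSeries.coeff i B‖ < (p : ℝ) ^ c) (h0 : ratPlusSymbol f 0 ≠ 0)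
    (hr0 : W.mordellWeilRank = 0) {Dh : PAdicHeightData W p} (hBcl : LeadingTermClauses W p Dh)
    {κ : ZpExtension ℚ p} {γ : Field.absoluteGaloisGroup ℚ}
    (hκ : κ.IsCyclotomic) (hγ : κ.IsTopGenerator γ) (hγ' : IsCyclotomicVariable p γ)
    (D : W.SelmerDualData κ γ) [Module.Finite (IwasawaAlgebra p) D.X]
    {fE : IwasawaAlgebra p} (hchar : D.charIdeal = Ideal.span {fE}) :
    Finite (AddCommGroup.primaryComponent W.sha p) ∧ lam fE = n ∧
      ∃ ℓ : ℕ, ℓ ∣ p ^ 2 ∧ (ReductionNonAnomalous W p → ℓ = 1) ∧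
        (padicValNat p (Nat.card (AddCommGroup.primaryComponent W.sha p)) : ℤ) +
            (padicRegulator Dh).valuation + padicValNat p W.tamagawaProduct + padicValNat p ℓ =
          X1.MuLambda.mu fE + padicValRat p (ratPlusSymbol f 0) + c + 2 * padicValNat p W.torsionOrder := by
  obtain ⟨-, -, hlam, -⟩ := lam_eq_and_exponent_eq_of_tameBranchRatCharEqAt hT hp2 hadd hloc hf hε hα hB
    hbd hn hlt hκ hγ hγ' D hchar
  have hT' : TameBranchRatDvdAt W p := tameBranchRatDvdAt_of_tameBranchRatCharEqAt W p hT
  obtain ⟨-, hfin, ℓ, hℓ, hna, -, hcrit⟩ := schneider_and_padicVal_le_rankZero_of_tameBranchRatDvdAt hT' hp2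
    hadd hloc hf hε hα hB hbd h0 hr0 hBcl hκ hγ hγ' D hchar
  obtain ⟨-, hiff⟩ := hcrit n hn hlt
  exact ⟨hfin, hlam, ℓ, hℓ, hna, hiff.mpr hlam⟩

omit [W.IsElliptic] [W.IsGloballyMinimal] in
/-- **THE LOOP CLOSED (Λ-level, per datum): λ-part ⟺ the rational main-conjecture shape.** For a cyclotomic
dual datum with generator `fE`, a RATIONAL divisibility `ι g = p^k·B` with `g ∈ char_Λ X` (`g = fE·h`),
`B` bounded by `p^c` with FIRST TOP at `n`: **`λ(fE) = n` if and only if `char_Λ X = (G)` for some `G` with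
`ι G = p^{k'}·B`, `k' ∈ ℤ`** — and then `k' = μ(fE) + c`. (Parts 1 §2 both ways.)
[cite: GreenbergVatsal2000, p. 4] [cite: Washington1997, §7.1] -/
theorem lam_eq_iff_exists_charIdeal_eq_span_and_iota_eq {κ : ZpExtension ℚ p}
    {γ : Field.absoluteGaloisGroup ℚ} (D : W.SelmerDualData κ γ)
    {fE g : IwasawaAlgebra p} (hchar : D.charIdeal = Ideal.span {fE}) (hg : g ∈ D.charIdeal) (hg0 : g ≠ 0)
    {k c : ℕ} {B : PowerSeries ℚ_[p]}
    (hι : iwasawaToPowerSeries p g = PowerSeries.C ((p : ℚ_[p]) ^ k) * B)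
    (hbd : ∀ j : ℕ, ‖PowerSeries.coeff j B‖ ≤ (p : ℝ) ^ c)
    {n : ℕ} (hn : ‖PowerSeries.coeff n B‖ = (p : ℝ) ^ c)
    (hlt : ∀ i < n, ‖PowerSeries.coeff i B‖ < (p : ℝ) ^ c) :
    lam fE = n ↔ ∃ (G : IwasawaAlgebra p) (k' : ℤ), D.charIdeal = Ideal.span {G} ∧
      iwasawaToPowerSeries p G = PowerSeries.C ((p : ℚ_[p]) ^ k') * B := by
  have hg' := hg
  rw [hchar] at hg'
  obtain ⟨h, hh⟩ := Ideal.mem_span_singleton'.mp hg'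
  have hfac : g = fE * h := by rw [← hh, mul_comm]
  have hfE0 : fE ≠ 0 := by intro h0; apply hg0; rw [hfac, h0, zero_mul]
  have hlamg : lam g = n := lam_eq_of_iota_eq_of_firstTop hg0 hι hbd hn hlt
  constructor
  · intro hlam
    obtain ⟨-, hspan, -, -, hιG⟩ :=
      exists_span_eq_and_iota_eq_zpow_of_lam_eq hfac hg0 hι (by rw [hlam, hlamg])
    exact ⟨fE * pfree h, (k : ℤ) - mu h, by rw [hchar, hspan], hιG⟩
  · rintro ⟨G, k', hspanG, hιG⟩
    have hspan : Ideal.span ({G} : Set (IwasawaAlgebra p)) = Ideal.span {fE} := by rw [← hspanG, hchar]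
    exact (lam_eq_and_exponent_eq_of_span_eq_of_iota_eq_zpow hfE0 hspan hιG hbd hn hlt).1

end Exact

end Summit.BirchSwinnertonDyer.Rank1Residual.Additive

end
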